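import Mathlib
import Summits.Ventures.PercRepro2.HCov
import Summits.Ventures.PercRepro2.HCovCubic
import Summits.Ventures.PercRepro2.HCovTyped
import Summits.Ventures.PercRepro2.TriDisagreement
import Summits.Ventures.PercRepro2.TriDisagreementPinned
import Summits.Ventures.PercRepro2.RECMReduction
import Summits.Ventures.PercRepro2.RECMReductionC
import Summits.Ventures.PercRepro2.GcTransport
import Summits.Ventures.PercRepro2.CCWReduction

/-!
# The typed bridge, typed side: (c-CW) on the typed bases ⟹ (c-CW) weighted ⟹ (HCOV), (c-RECM)
(blind cell PercRepro2, p1 g11; lead g19 ASSIGNMENTS v12.12 (b): «∀ k′: N_{(k′,j)} ≥ c · N_{(k′,3)}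
(j = 1, 2) at unmarked-y root edges ⟹ cRECM_all c»)

**(c-CW), typed** (`cCWTypedAt c ends … e`): for every minor `(F, z)` with `e ∉ F`, every type map
with values in `{1, 2}` on `F` and `j = 1, 2`,

  `c · typedCount F (z[e ↦ open]) τ K₃ ≤ typedCount (insert e F) z (τ[e ↦ j]) K₃`

— `N_{(k′,j)} ≥ c · N_{(k′,3)}` in the cell's vocabulary (`typedCount` of `TriDisagreementPinned`;
`k′` = the types of the other edges: `{1, 2}` on `F`, pinned off `F`).

* **`triSum_cCW_of_typed`**: the weighted inequality
  `c · t^j (1 − t)^{3−j} · triSum p[e↦1] F τ K₃ ≤ triSum p (insert e F) (τ[e ↦ j]) K₃` for every weight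
  vector with values in `[0, 1]` — the pinning induction of `triSum_nonneg_of_pinned` run on the
  DIFFERENCE of the two sides (invariant: `e` stays in the typed set), with the typed (c-CW) as the
  base case (`triSum_pinned_eq` on both sides);
* **`cCWAt_of_typed`**: typed (c-CW) at `e` ⟹ weighted (c-CW) `cCWAt` at `e` (`F = ∅`, then
  `Gc_update_one_eq_contract`); **`cCW_all_of_typed`**: the closure form;
* **`HCov_all_of_cCWTyped_all`** and **`cRECM_all_of_cCWTyped_all`**: the lead's statement with
  the typed hypothesis — `0 ≤ c → cCWTyped_all c → HCovR_all → HCov_all` and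
  `… → cRECM_all (c − c²/4)`;
* **`TypedBasesR_all`** (row 2′TRI on class R — the cell's paper theorem, night-3 g2) and
  **`HCov_all_of_cCWTyped_all_of_typedBasesR`**: `0 ≤ c → cCWTyped_all c → TypedBasesR_all →
  HCov_all` — the (root) residual map of record in one Lean statement: the crux from the typed
  (c-CW) at unmarked-`y` root edges and the typed bases on class R.
-/

namespace Summit.Ventures.PercRepro2

open CovForm Contract

namespace RECM

section Typed

variable {V : Type*} {E : Type*} [Fintype E] [DecidableEq E] [DecidableEq V] {R : Type*}
  [Field R] [LinearOrder R] [IsStrictOrderedRing R]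

/-- **(c-CW) at the edge `e`, typed form**: on every minor `(F, z)` with `e ∉ F` and every type map
with values in `{1, 2}` on `F`, the typed counts with `e` of type `j = 1, 2` dominate `c` times the
typed count with `e` open in all three copies (`N_{(k′,j)} ≥ c · N_{(k′,3)}`). -/
def cCWTypedAt (c : R) (ends : E → Sym2 V) (o a₁ a₂ a₃ b : V) (e : E) : Prop :=
  ∀ (F : Finset E) (z : Config E) (τ : E → ℕ), e ∉ F → (∀ f ∈ F, τ f = 1 ∨ τ f = 2) →
    ∀ j : ℕ, j = 1 ∨ j = 2 →
      c * typedCount F (Function.update z e true) τ (K3 ends o a₁ a₂ a₃ b : Config E → Config E → Config E → R) ≤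
        typedCount (insert e F) z (Function.update τ e j) (K3 ends o a₁ a₂ a₃ b)

omit [Fintype E] [DecidableEq V] [IsStrictOrderedRing R] in
/-- The pinned configuration of `p[e ↦ 1]` is the pinned configuration of `p` with `e` open. -/
lemma pinnedConfig_update_one (p : E → R) (e : E) :
    pinnedConfig (Function.update p e 1) = Function.update (pinnedConfig p) e true := by
  funext f
  by_cases hf : f = e
  · subst hf
    simp [pinnedConfig]
  · simp [pinnedConfig, Function.update_of_ne hf]

omit [DecidableEq V] in
/-- **The typed (c-CW) transfers to every weight vector** (the pinning induction on the difference of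
the two sides, `e` kept in the typed set): `c · t^j (1 − t)^{3−j} · triSum p[e↦1] F τ K₃ ≤
triSum p (insert e F) (τ[e ↦ j]) K₃`. -/
theorem triSum_cCW_of_typed {c : R} {ends : E → Sym2 V} {o a₁ a₂ a₃ b : V} {e : E}
    (hT : cCWTypedAt c ends o a₁ a₂ a₃ b e) {j : ℕ} (hj : j = 1 ∨ j = 2) (p : E → R)
    (hp : ∀ f, 0 ≤ p f ∧ p f ≤ 1) (F : Finset E) (heF : e ∉ F) (τ : E → ℕ)
    (hτ : ∀ f ∈ F, τ f = 1 ∨ τ f = 2) :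
    c * (p e ^ j * (1 - p e) ^ (3 - j) *
        triSum (Function.update p e 1) F τ (K3 ends o a₁ a₂ a₃ b)) ≤
      triSum p (insert e F) (Function.update τ e j) (K3 ends o a₁ a₂ a₃ b) := by
  generalize hn : (triFracFree p (insert e F)).card = n
  induction n using Nat.strong_induction_on generalizing p F τ with
  | _ n ih =>
    by_cases h0 : triFracFree p (insert e F) = ∅
    · -- base: every edge off `insert e F` is pinned — both sides are typed counts
      have hpin : ∀ f, f ∉ insert e F → p f = 0 ∨ p f = 1 := by
        intro f hf
        by_contra hcon
        rw [not_or] at hcon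
        have : f ∈ triFracFree p (insert e F) := mem_triFracFree.mpr ⟨hf, hcon.1, hcon.2⟩
        rw [h0] at this
        exact absurd this (Finset.notMem_empty f)
      have hpin1 : ∀ f, f ∉ F → Function.update p e 1 f = 0 ∨ Function.update p e 1 f = 1 := by
        intro f hf
        by_cases hfe : f = e
        · subst hfe
          simp
        · rw [Function.update_of_ne hfe]
          exact hpin f (fun h => hf (Finset.mem_of_mem_insert_of_ne h hfe))
      rw [triSum_pinned_eq p (insert e F) hpin _ _,
        triSum_pinned_eq (Function.update p e 1) F hpin1 _ _, Finset.prod_insert heF,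
        Function.update_self, pinnedConfig_update_one]
      have hprod : (∏ f ∈ F, Function.update p e 1 f ^ τ f * (1 - Function.update p e 1 f) ^ (3 - τ f)) =
          ∏ f ∈ F, p f ^ τ f * (1 - p f) ^ (3 - τ f) := by
        refine Finset.prod_congr rfl fun f hf => ?_
        rw [Function.update_of_ne (fun h => heF (by rw [← h]; exact hf))]
      have hprod' : (∏ f ∈ F, p f ^ Function.update τ e j f * (1 - p f) ^ (3 - Function.update τ e j f)) =
          ∏ f ∈ F, p f ^ τ f * (1 - p f) ^ (3 - τ f) := by
        refine Finset.prod_congr rfl fun f hf => ?_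
        rw [Function.update_of_ne (fun h => heF (by rw [← h]; exact hf))]
      rw [hprod, hprod']
      have hw : 0 ≤ p e ^ j * (1 - p e) ^ (3 - j) * ∏ f ∈ F, p f ^ τ f * (1 - p f) ^ (3 - τ f) :=
        mul_nonneg (mul_nonneg (pow_nonneg (hp e).1 _) (pow_nonneg (sub_nonneg.mpr (hp e).2) _))
          (prod_typed_factors_nonneg p hp F τ)
      have hbase := hT F (pinnedConfig p) τ heF hτ j hj
      calc c * (p e ^ j * (1 - p e) ^ (3 - j) *
            ((∏ f ∈ F, p f ^ τ f * (1 - p f) ^ (3 - τ f)) *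
              typedCount F (Function.update (pinnedConfig p) e true) τ (K3 ends o a₁ a₂ a₃ b)))
          = (p e ^ j * (1 - p e) ^ (3 - j) * ∏ f ∈ F, p f ^ τ f * (1 - p f) ^ (3 - τ f)) *
              (c * typedCount F (Function.update (pinnedConfig p) e true) τ
                (K3 ends o a₁ a₂ a₃ b)) := by ring
        _ ≤ (p e ^ j * (1 - p e) ^ (3 - j) * ∏ f ∈ F, p f ^ τ f * (1 - p f) ^ (3 - τ f)) *
              typedCount (insert e F) (pinnedConfig p) (Function.update τ e j)
                (K3 ends o a₁ a₂ a₃ b) := mul_le_mul_of_nonneg_left hbase hw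
        _ = _ := by ring
    · -- step: pin a free fractional edge `f ∉ insert e F`
      obtain ⟨f, hf⟩ := Finset.nonempty_iff_ne_empty.mpr h0
      have hfeF : f ∉ insert e F := (mem_triFracFree.mp hf).1
      have hfe : f ≠ e := fun h => hfeF (h ▸ Finset.mem_insert_self e F)
      have hfF : f ∉ F := fun h => hfeF (Finset.mem_insert_of_mem h)
      have hlt : ((triFracFree p (insert e F)).erase f).card < n := by
        rw [← hn]
        exact Finset.card_erase_lt_of_mem hf
      have hp0 : ∀ f', 0 ≤ Function.update p f 0 f' ∧ Function.update p f 0 f' ≤ 1 := by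
        intro f'
        by_cases h : f' = f
        · subst h; simp
        · rw [Function.update_of_ne h]; exact hp f'
      have hp1 : ∀ f', 0 ≤ Function.update p f 1 f' ∧ Function.update p f 1 f' ≤ 1 := by
        intro f'
        by_cases h : f' = f
        · subst h; simp
        · rw [Function.update_of_ne h]; exact hp f'
      have hτ1 : ∀ f' ∈ insert f F, Function.update τ f 1 f' = 1 ∨ Function.update τ f 1 f' = 2 := by
        intro f' hf'
        by_cases h : f' = f
        · subst h; simp
        · rw [Function.update_of_ne h]
          exact hτ f' (Finset.mem_of_mem_insert_of_ne hf' h)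
      have hτ2 : ∀ f' ∈ insert f F, Function.update τ f 2 f' = 1 ∨ Function.update τ f 2 f' = 2 := by
        intro f' hf'
        by_cases h : f' = f
        · subst h; simp
        · rw [Function.update_of_ne h]
          exact hτ f' (Finset.mem_of_mem_insert_of_ne hf' h)
      have heF' : e ∉ insert f F := by
        intro h
        rcases Finset.mem_insert.mp h with h | h
        · exact hfe h.symm
        · exact heF h
      have hc0 : (triFracFree (Function.update p f 0) (insert e F)).card =
          ((triFracFree p (insert e F)).erase f).card := by
        rw [triFracFree_update p (insert e F) f 0 (Or.inl rfl)]
      have hc1 : (triFracFree (Function.update p f 1) (insert e F)).card =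
          ((triFracFree p (insert e F)).erase f).card := by
        rw [triFracFree_update p (insert e F) f 1 (Or.inr rfl)]
      have hc2 : (triFracFree p (insert e (insert f F))).card =
          ((triFracFree p (insert e F)).erase f).card := by
        rw [Finset.insert_comm, triFracFree_insert]
      have h1 := ih _ hlt (Function.update p f 0) hp0 F heF τ hτ hc0
      have h2 := ih _ hlt (Function.update p f 1) hp1 F heF τ hτ hc1
      have h3 := ih _ hlt p hp (insert f F) heF' (Function.update τ f 1) hτ1 hc2
      have h4 := ih _ hlt p hp (insert f F) heF' (Function.update τ f 2) hτ2 hc2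
      -- rewrite the pinned weights at `e` and commute the updates
      rw [Function.update_of_ne hfe.symm, Function.update_comm hfe] at h1
      rw [Function.update_of_ne hfe.symm, Function.update_comm hfe] at h2
      rw [Finset.insert_comm, Function.update_comm hfe] at h3
      rw [Finset.insert_comm, Function.update_comm hfe] at h4
      rw [triSum_pin p hfeF (Function.update τ e j) (K3 ends o a₁ a₂ a₃ b),
        triSum_pin (Function.update p e 1) hfF τ (K3 ends o a₁ a₂ a₃ b),
        Function.update_of_ne hfe]
      have hpf := hp f
      have h0' : 0 ≤ (1 - p f) ^ 3 := pow_nonneg (sub_nonneg.mpr hpf.2) 3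
      have h1' : 0 ≤ p f ^ 3 := pow_nonneg hpf.1 3
      have := mul_le_mul_of_nonneg_left h1 h0'
      have := mul_le_mul_of_nonneg_left h2 h1'
      linarith

/-- **Typed (c-CW) at `e` ⟹ weighted (c-CW) at `e`** (`F = ∅`, then `Gc_update_one_eq_contract`). -/
theorem cCWAt_of_typed {c : R} (p : E → R) (hp : IsProbVec p) {ends : E → Sym2 V} {e : E}
    {o a₁ a₂ a₃ b y : V} (hg : ends e = s(a₁, y)) (hy : Unmarked o a₁ a₂ a₃ b y) (ho1 : o ≠ a₁)
    (h12 : a₁ ≠ a₂) (h13 : a₁ ≠ a₃) (hb1 : b ≠ a₁) (hT : cCWTypedAt c ends o a₁ a₂ a₃ b e) :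
    cCWAt c p ends o a₁ a₂ a₃ b e y := by
  intro j hj
  have key := triSum_cCW_of_typed hT hj p (fun f => ⟨hp.nonneg f, hp.le_one f⟩) ∅
    (Finset.notMem_empty e) (fun _ => 0) (fun f hf => absurd hf (Finset.notMem_empty f))
  rw [← hcov_cubic (Function.update p e 1) ends o a₁ a₂ a₃ b (fun _ => 0),
    Gc_update_one_eq_contract p hg hy ho1 h12 h13 hb1, Finset.insert_empty,
    triSum_congr_types p {e} (τ := Function.update (fun _ => 0) e j) (τ' := fun _ => j)
      (fun f hf => by rw [Finset.mem_singleton.mp hf, Function.update_self])] at key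
  exact key

end Typed

section Closure

variable (R : Type*) [Field R] [LinearOrder R] [IsStrictOrderedRing R]

/-- **Row (c-CW), typed** (LEAD-CCW §2): `N_{(k′,j)} ≥ c · N_{(k′,3)}` (`j = 1, 2`) at every root
edge `e = {a₁, y}` with `y` unmarked, on every minor of every finite graph with distinct marks —
weight-free. -/
def cCWTyped_all (c : R) : Prop :=
  ∀ (V E : Type) [Fintype V] [DecidableEq V] [Fintype E] [DecidableEq E] (ends : E → Sym2 V),
    ∀ o a₁ a₂ a₃ b : V, a₁ ≠ a₂ → a₁ ≠ a₃ → a₂ ≠ a₃ → o ≠ a₁ → o ≠ a₂ → o ≠ a₃ → o ≠ b →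
      b ≠ a₁ → b ≠ a₂ → b ≠ a₃ → ∀ (y : V) (e : E), Unmarked o a₁ a₂ a₃ b y → ends e = s(a₁, y) →
        cCWTypedAt c ends o a₁ a₂ a₃ b e

variable {R}

/-- Typed (c-CW) everywhere gives weighted (c-CW) everywhere. -/
theorem cCW_all_of_typed {c : R} (hT : cCWTyped_all R c) : cCW_all R c := by
  intro V E _ _ _ _ ends p hp o a₁ a₂ a₃ b h12 h13 h23 ho1 ho2 ho3 hob hb1 hb2 hb3 y e hy he
  exact cCWAt_of_typed p hp he hy ho1 h12 h13 hb1
    (hT V E ends o a₁ a₂ a₃ b h12 h13 h23 ho1 ho2 ho3 hob hb1 hb2 hb3 y e hy he)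

/-- **THE TYPED BRIDGE**: `0 ≤ c → cCWTyped_all c → HCovR_all → HCov_all` — (HCOV) for every
finite weighted graph from the typed (c-CW) at unmarked-`y` root edges and (HCOV) on class R. -/
theorem HCov_all_of_cCWTyped_all {c : R} (hc : 0 ≤ c) (hT : cCWTyped_all R c)
    (hB : HCovR_all R) : HCov_all R :=
  HCov_all_of_cCW_all hc (cCW_all_of_typed hT) hB

/-- **(c-CW) typed ⟹ (c-RECM)** with the constant `c − c²/4` (ASSIGNMENTS v12.12 (b), honest
form: the deletion term is supplied by the induction behind `HCov_all_of_cCW_all`). -/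
theorem cRECM_all_of_cCWTyped_all {c : R} (hc : 0 ≤ c) (hT : cCWTyped_all R c)
    (hB : HCovR_all R) : cRECM_all R (c - c ^ 2 / 4) :=
  cRECM_all_of_cCW_all hc (cCW_all_of_typed hT) hB

variable (R)

/-- **Row 2′TRI on class R** (the hub theorem in typed form — the cell's paper theorem): every typed
three-copy base of `K₃` is nonnegative on every finite graph with distinct marks in which every edge
at a root ends in a mark. -/
def TypedBasesR_all : Prop :=
  ∀ (V E : Type) [Fintype V] [DecidableEq V] [Fintype E] [DecidableEq E] (ends : E → Sym2 V),
    ∀ o a₁ a₂ a₃ b : V, a₁ ≠ a₂ → a₁ ≠ a₃ → a₂ ≠ a₃ → o ≠ a₁ → o ≠ a₂ → o ≠ a₃ → o ≠ b →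
      b ≠ a₁ → b ≠ a₂ → b ≠ a₃ → RootsToMarks ends o a₁ a₂ a₃ b →
        TypedBases (R := R) ends o a₁ a₂ a₃ b

variable {R}

/-- Typed 2′TRI on class R gives (HCOV) on class R for every admissible weight vector
(`HCov_of_typedBases`). -/
theorem HCovR_all_of_typedBasesR (h : TypedBasesR_all R) : HCovR_all R := by
  intro V E _ _ _ _ ends p hp o a₁ a₂ a₃ b h12 h13 h23 ho1 ho2 ho3 hob hb1 hb2 hb3 hR
  exact HCov_of_typedBases ends o a₁ a₂ a₃ b
    (h V E ends o a₁ a₂ a₃ b h12 h13 h23 ho1 ho2 ho3 hob hb1 hb2 hb3 hR) p hp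

/-- **THE (root) RESIDUAL MAP IN ONE STATEMENT**: `0 ≤ c → cCWTyped_all c → TypedBasesR_all →
HCov_all` — (HCOV) for every finite weighted graph from the typed (c-CW) at unmarked-`y` root edges
and the typed bases on class R. -/
theorem HCov_all_of_cCWTyped_all_of_typedBasesR {c : R} (hc : 0 ≤ c) (hT : cCWTyped_all R c)
    (hR : TypedBasesR_all R) : HCov_all R :=
  HCov_all_of_cCWTyped_all hc hT (HCovR_all_of_typedBasesR hR)

end Closure

end RECM

end Summit.Ventures.PercRepro2
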